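import Literature.Computability.Complexity.CodeFPListKit
import Literature.Computability.Complexity.CodeFPStrings
import Literature.Computability.Complexity.ClayProblem
import Summits.PneNP.PneNP.Theorems.Nc03AvoidResidualCoreCandFewHeadsRungFP
import Summits.PneNP.PneNP.Theorems.Nc03AvoidResidualCoreCandMatchRungFPSearch

/-!
# Route Nc03AvoidResidualCore — the matching-class rung LITERALLY TYPED, part 2/2: `avoidStr2 ∈ FP` and the rung `LocalAvoidLinearFP 3 (IsPure candPred ∧ IsMatchingClass ∧ headCount³ ≤ k·n)`

Tribunal-w (D-0033 T3), generation 3, for `route-PneNP-Nc03AvoidResidualCore`, item `stmt-PneNP-20226`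
(`CandAvoidLinearFP = LocalAvoidLinearFP 3 (IsPure candPred)`). Part 1
(`Nc03AvoidResidualCoreCandMatchRungFPSearch`) defined the aligned-pack search on token data and proved
its answer correct (`answer2_not_mem_range`); here the string function
`avoidStr2 = answer2 ∘ (m, outputs) ∘ runs` is assembled in the tree's typed `CodeFP` algebra from the
gen-2 decoder (`codeFP_runs`, `codeFP_mTok`, `codeFP_tripsTok`, `codeFP_tri`, `codeFP_eqU` of
`Nc03AvoidResidualCoreCandFewHeadsRungFP`) and the library combinators `rawProduct`, `map₀` /
`map`, `rawAppend`, `rawSingleton` (the `m²⁴` candidate packs by three doublings), `all` / `and` /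
`or` / `not` / `natEq` / `rawGetOr` (the test `packN`), `rawFind?`, `optCases` (the answer), whence
`avoidStr2 ∈ FP`, `IsPolyTime avoidStr2` (bridge `isPolyTime_iff`) and

**`candMatch_rungFP (k) : LocalAvoidLinearFP 3 (fun n _ I => I.IsPure candPred ∧ IsMatchingClass I ∧ headCount I ^ 3 ≤ k * n)`**

— the crux C₁ with its side condition strengthened to the matching-class family with at most
`(k·n)^{1/3}` head classes (C₁ ⇒ rung: `Nc03AvoidResidualCoreCandMatchRung.candAvoidLinearFP_imp_candMatch`,
identical conclusion type). Same lever and placement as the explicit-avoider form `candMatch_rung`: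
a rung INSIDE the `CAND^match` core where the few-heads certificates are vacuous
(`no_certificate_of_isMatchingClass`); the regime `headCount ≫ n^{1/3}` is untouched.

Restricted-model algorithmic rung of the range-avoidance ladder; no bearing on `P` versus `NP`.
-/

set_option linter.dupNamespace false -- `Summit.PneNP.PneNP.…`: summit = sub-problem name (D-0017 single-conjunct layout)

namespace Summit.PneNP.PneNP.Theorems.Nc03AvoidResidualCoreCandMatchRungFP

open Literature.Computability.Complexity
open Summit.PneNP.PneNP.Theorems.Nc03AvoidResidualCoreCandFewHeadsRung
open Summit.PneNP.PneNP.Theorems.Nc03AvoidResidualCoreCandFewHeadsRungFP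
open Summit.PneNP.PneNP.Theorems.Nc03AvoidResidualCoreCandMatchRung

/-! ## `avoidStr2` is polynomial time: assembly in the typed `CodeFP` algebra -/

section PolyTime

open CodeFP Polynomial

/-- Code of an output index triple (binary indices). -/
abbrev ixE : ℕ × ℕ × ℕ → List Bool := pairE natE (pairE natE natE)

/-- Code of the test context `(outputs, candidate)`. -/
abbrev pcE : List (ℕ × ℕ × ℕ) × List (ℕ × ℕ × ℕ) → List Bool := pairE (rawE tripE) (rawE ixE)

/-- Code of the answer context `(candidate, output index)`. -/
abbrev aE : List (ℕ × ℕ × ℕ) × ℕ → List Bool := pairE (rawE ixE) natE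

variable {α : Type} {eα : α → List Bool}

/-- Indexed access to a computed index-triple list is polynomial time. -/
theorem codeFP_triI {gL : α → List (ℕ × ℕ × ℕ)} {gj : α → ℕ} (hL : CodeFP eα (rawE ixE) gL)
    (hj : CodeFP eα natE gj) : CodeFP eα ixE (fun a => tri (gL a) (gj a)) :=
  ((rawGetOr ixE).comp (hL.pair (hj.pair (const eα (eβ := ixE) ((0 : ℕ), (0 : ℕ), (0 : ℕ)))))).congr
    fun _ => rfl

/-- Comparison with a constant is polynomial time. -/
theorem codeFP_eqC (c : ℕ) : CodeFP natE bitE (fun i => decide (i = c)) :=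
  (natEq.comp ((CodeFP.id natE).pair (const natE c))).congr fun _ => rfl

/-- The u-flank pattern bit `α` is polynomial time. -/
theorem codeFP_patA : CodeFP natE bitE (fun i => (patN i).1) :=
  ((((codeFP_eqC 4).or (codeFP_eqC 5)).or (codeFP_eqC 6)).or (codeFP_eqC 7)).congr fun _ => rfl

/-- The middle pattern bit `β` is polynomial time. -/
theorem codeFP_patB : CodeFP natE bitE (fun i => (patN i).2.1) :=
  ((((codeFP_eqC 2).or (codeFP_eqC 3)).or (codeFP_eqC 6)).or (codeFP_eqC 7)).congr fun _ => rfl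

/-- The v-flank pattern bit `γ` is polynomial time. -/
theorem codeFP_patC : CodeFP natE bitE (fun i => (patN i).2.2) :=
  ((((codeFP_eqC 1).or (codeFP_eqC 3)).or (codeFP_eqC 5)).or (codeFP_eqC 7)).congr fun _ => rfl

/-! ### The test `packN` -/

/-- The per-position clauses of `packN` are polynomial time. -/
theorem codeFP_clauses :
    CodeFP (pairE pcE natE) bitE
        (fun q => decide ((tri q.1.1 (tri q.1.2 q.2).2.1).1 = (tri q.1.1 (tri q.1.2 0).2.1).1)) ∧
      CodeFP (pairE pcE natE) bitE
        (fun q => decide ((tri q.1.1 (tri q.1.2 q.2).1).1 = (tri q.1.1 (tri q.1.2 0).1).1)) ∧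
      CodeFP (pairE pcE natE) bitE
        (fun q => decide ((tri q.1.1 (tri q.1.2 q.2).2.2).1 = (tri q.1.1 (tri q.1.2 0).2.2).1)) ∧
      CodeFP (pairE pcE natE) bitE (fun q => memN q.1.1 (tri q.1.1 (tri q.1.2 q.2).2.1).2.1 (tri q.1.2 q.2).1) ∧
      CodeFP (pairE pcE natE) bitE (fun q => memN q.1.1 (tri q.1.1 (tri q.1.2 q.2).2.1).2.2 (tri q.1.2 q.2).2.2) := by
  have hL : CodeFP (pairE pcE natE) (rawE tripE) (fun q => q.1.1) := (fst _ _).fst'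
  have hl : CodeFP (pairE pcE natE) (rawE ixE) (fun q => q.1.2) := (fst _ _).snd'
  have gi := codeFP_triI hl (snd pcE natE)
  have g0 := codeFP_triI hl (const (pairE pcE natE) (eβ := natE) 0)
  have tm := codeFP_tri hL gi.snd'.fst'
  have tu := codeFP_tri hL gi.fst'
  have tv := codeFP_tri hL gi.snd'.snd'
  refine ⟨(codeFP_eqU tm.fst' (codeFP_tri hL g0.snd'.fst').fst').congr fun _ => rfl,
    (codeFP_eqU tu.fst' (codeFP_tri hL g0.fst').fst').congr fun _ => rfl,
    (codeFP_eqU tv.fst' (codeFP_tri hL g0.snd'.snd').fst').congr fun _ => rfl,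
    ((codeFP_eqU tm.snd'.fst' tu.snd'.fst').or (codeFP_eqU tm.snd'.fst' tu.snd'.snd')).congr fun _ => rfl,
    ((codeFP_eqU tm.snd'.snd' tv.snd'.fst').or (codeFP_eqU tm.snd'.snd' tv.snd'.snd')).congr fun _ => rfl⟩

/-- The pair clauses of `packN` are polynomial time. -/
theorem codeFP_pairClauses :
    CodeFP (pairE pcE idxE) bitE (fun q => !decide ((tri q.1.2 q.2.1).1 = (tri q.1.2 q.2.2).2.1)) ∧
      CodeFP (pairE pcE idxE) bitE (fun q => !decide ((tri q.1.2 q.2.1).2.2 = (tri q.1.2 q.2.2).2.1)) ∧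
      CodeFP (pairE pcE idxE) bitE (fun q => decide (q.2.1 = q.2.2) ||
        (!decide ((tri q.1.2 q.2.1).2.1 = (tri q.1.2 q.2.2).2.1) && !decide ((tri q.1.2 q.2.1).1 = (tri q.1.2 q.2.2).1) &&
          !decide ((tri q.1.2 q.2.1).1 = (tri q.1.2 q.2.2).2.2) &&
          !decide ((tri q.1.2 q.2.1).2.2 = (tri q.1.2 q.2.2).2.2))) := by
  have eqN {g h : (List (ℕ × ℕ × ℕ) × List (ℕ × ℕ × ℕ)) × (ℕ × ℕ) → ℕ} (hg : CodeFP (pairE pcE idxE) natE g)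
      (hh : CodeFP (pairE pcE idxE) natE h) : CodeFP (pairE pcE idxE) bitE (fun a => decide (g a = h a)) :=
    (natEq.comp (hg.pair hh)).congr fun _ => rfl
  have hl : CodeFP (pairE pcE idxE) (rawE ixE) (fun q => q.1.2) := (fst _ _).snd'
  have g1 := codeFP_triI hl (snd pcE idxE).fst'
  have g2 := codeFP_triI hl (snd pcE idxE).snd'
  refine ⟨(eqN g1.fst' g2.snd'.fst').not, (eqN g1.snd'.snd' g2.snd'.fst').not,
    ((natEq.comp (snd pcE idxE)).or
      ((((eqN g1.snd'.fst' g2.snd'.fst').not.and (eqN g1.fst' g2.fst').not).and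
        (eqN g1.fst' g2.snd'.snd').not).and (eqN g1.snd'.snd' g2.snd'.snd').not)).congr
      fun _ => rfl⟩

/-- A clause quantified over the positions `R8` is polynomial time. -/
theorem codeFP_allR8 {p : (List (ℕ × ℕ × ℕ) × List (ℕ × ℕ × ℕ)) × ℕ → Bool}
    (hp : CodeFP (pairE pcE natE) bitE p) : CodeFP pcE bitE (fun x => R8.all fun i => p (x, i)) :=
  ((all hp).comp ((CodeFP.id pcE).pair (const pcE (eβ := rawE natE) R8))).congr fun _ => rfl

/-- A clause quantified over the position pairs `R88` is polynomial time. -/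
theorem codeFP_allR88 {p : (List (ℕ × ℕ × ℕ) × List (ℕ × ℕ × ℕ)) × (ℕ × ℕ) → Bool}
    (hp : CodeFP (pairE pcE idxE) bitE p) : CodeFP pcE bitE (fun x => R88.all fun i => p (x, i)) :=
  ((all hp).comp ((CodeFP.id pcE).pair (const pcE (eβ := rawE idxE) R88))).congr fun _ => rfl

/-- **The aligned-pack test is polynomial time.** -/
theorem codeFP_packN : CodeFP pcE bitE (fun x => packN x.1 x.2) := by
  obtain ⟨c1, c2, c3, c4, c5⟩ := codeFP_clauses
  obtain ⟨c6, c7, c8⟩ := codeFP_pairClauses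
  exact ((((((((codeFP_allR8 c1).and (codeFP_allR8 c2)).and (codeFP_allR8 c3)).and (codeFP_allR8 c4)).and
    (codeFP_allR8 c5)).and (codeFP_allR88 c6)).and (codeFP_allR88 c7)).and (codeFP_allR88 c8)).congr
    fun _ => rfl

/-! ### The candidates and the search -/

/-- Listing the output index triples is polynomial time. -/
theorem codeFP_tripsR : CodeFP unE (rawE ixE) tripsR :=
  ((rawProduct natE idxE).comp (urange.pair codeFP_pairsR)).congr fun _ => rfl

/-- Doubling is polynomial time. -/
theorem codeFP_dbl : CodeFP (rawE (rawE ixE)) (rawE (rawE ixE)) dbl :=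
  ((map₀ (rawAppend ixE)).comp ((rawProduct (rawE ixE) (rawE ixE)).comp
    ((CodeFP.id (rawE (rawE ixE))).pair (CodeFP.id (rawE (rawE ixE)))))).congr fun _ => rfl

/-- Listing the `m²⁴` candidate packs is polynomial time (in the unary `m`). -/
theorem codeFP_cands : CodeFP unE (rawE (rawE ixE)) cands :=
  (codeFP_dbl.comp (codeFP_dbl.comp (codeFP_dbl.comp ((map₀ (rawSingleton ixE)).comp codeFP_tripsR)))).congr
    fun _ => rfl

/-- **The pack search is polynomial time.** -/
theorem codeFP_findPack : CodeFP ctxE (optE (rawE ixE)) (fun x => (cands x.1).find? (packN x.2)) :=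
  ((rawFind? codeFP_packN).comp
    ((snd unE (rawE tripE)).pair (codeFP_cands.comp (fst unE (rawE tripE))))).congr fun _ => rfl

/-! ### The answer -/

/-- The three position searches of `ansBitN` are polynomial time. -/
theorem codeFP_finds :
    CodeFP aE (optE natE) (fun s => R8.find? fun i => decide ((tri s.1 i).2.1 = s.2)) ∧
      CodeFP aE (optE natE) (fun s => R8.find? fun i => decide ((tri s.1 i).1 = s.2)) ∧
      CodeFP aE (optE natE) (fun s => R8.find? fun i => decide ((tri s.1 i).2.2 = s.2)) := by
  have eqN {g h : (List (ℕ × ℕ × ℕ) × ℕ) × ℕ → ℕ} (hg : CodeFP (pairE aE natE) natE g)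
      (hh : CodeFP (pairE aE natE) natE h) : CodeFP (pairE aE natE) bitE (fun a => decide (g a = h a)) :=
    (natEq.comp (hg.pair hh)).congr fun _ => rfl
  have g := codeFP_triI ((fst aE natE).fst') (snd aE natE)
  have o : CodeFP (pairE aE natE) natE (fun r => r.1.2) := (fst aE natE).snd'
  have hR : CodeFP aE (pairE aE (rawE natE)) (fun s => (s, R8)) :=
    (CodeFP.id aE).pair (const aE (eβ := rawE natE) R8)
  exact ⟨((rawFind? (eqN g.snd'.fst' o)).comp hR).congr fun _ => rfl,
    ((rawFind? (eqN g.fst' o)).comp hR).congr fun _ => rfl,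
    ((rawFind? (eqN g.snd'.snd' o)).comp hR).congr fun _ => rfl⟩

/-- **The certificate answer bit is polynomial time.** -/
theorem codeFP_ansBitN : CodeFP aE bitE (fun s => ansBitN s.1 s.2) := by
  obtain ⟨f1, f2, f3⟩ := codeFP_finds
  have e3 : CodeFP aE bitE
      (fun s => (R8.find? fun i => decide ((tri s.1 i).2.2 = s.2)).elim false fun i => !(patN i).2.2) :=
    (optCases (eσ := aE) (eα := natE) (eδ := bitE)
      (k := fun (_ : List (ℕ × ℕ × ℕ) × ℕ) (o : Option ℕ) => o.elim false fun i => !(patN i).2.2)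
      (const aE false) ((codeFP_patC.comp (snd aE natE)).not) (fun _ => rfl) (fun _ _ => rfl)).comp
      ((CodeFP.id aE).pair f3)
  have e2 : CodeFP aE bitE
      (fun s => (R8.find? fun i => decide ((tri s.1 i).1 = s.2)).elim
        ((R8.find? fun i => decide ((tri s.1 i).2.2 = s.2)).elim false fun i => !(patN i).2.2)
        fun i => !(patN i).1) :=
    (optCases (eσ := aE) (eα := natE) (eδ := bitE)
      (k := fun (s : List (ℕ × ℕ × ℕ) × ℕ) (o : Option ℕ) => o.elim
        ((R8.find? fun i => decide ((tri s.1 i).2.2 = s.2)).elim false fun i => !(patN i).2.2)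
        fun i => !(patN i).1)
      e3 ((codeFP_patA.comp (snd aE natE)).not) (fun _ => rfl) (fun _ _ => rfl)).comp
      ((CodeFP.id aE).pair f2)
  exact ((optCases (eσ := aE) (eα := natE) (eδ := bitE)
      (k := fun (s : List (ℕ × ℕ × ℕ) × ℕ) (o : Option ℕ) => o.elim
        ((R8.find? fun i => decide ((tri s.1 i).1 = s.2)).elim
          ((R8.find? fun i => decide ((tri s.1 i).2.2 = s.2)).elim false fun i => !(patN i).2.2)
          fun i => !(patN i).1)
        fun i => (patN i).2.1)
      e2 (codeFP_patB.comp (snd aE natE)) (fun _ => rfl) (fun _ _ => rfl)).comp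
      ((CodeFP.id aE).pair f1)).congr fun _ => rfl

/-- The tabulated pack answer is polynomial time. -/
theorem codeFP_ansPackN : CodeFP (pairE unE (rawE ixE)) (rawE bitE) (fun p => ansPackN p.1 p.2) :=
  ((map codeFP_ansBitN).comp
    ((snd unE (rawE ixE)).pair (urange.comp (fst unE (rawE ixE))))).congr fun _ => rfl

/-- **The answer on token data is polynomial time.** -/
theorem codeFP_answer2 : CodeFP ctxE (rawE bitE) (fun x => answer2 x.1 x.2) :=
  ((optCases (eσ := ctxE) (eα := rawE ixE) (eδ := rawE bitE)
      (k := fun (s : ℕ × List (ℕ × ℕ × ℕ)) (o : Option (List (ℕ × ℕ × ℕ))) => o.elim (ansNone s.1) (ansPackN s.1))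
      (codeFP_ansNone.comp (fst unE (rawE tripE)))
      (codeFP_ansPackN.comp ((fst ctxE (rawE ixE)).fst'.pair (snd ctxE (rawE ixE))))
      (fun _ => rfl) (fun _ _ => rfl)).comp
    ((CodeFP.id ctxE).pair codeFP_findPack)).congr fun _ => rfl

/-- **The avoider is computed on codes by an `FP` string function.** -/
theorem codeFP_avoidStr2 : CodeFP strE strE avoidStr2 :=
  (bitsToStr.comp (codeFP_answer2.comp ((codeFP_mTok.pair codeFP_tripsTok).comp codeFP_runs))).congr
    fun _ => rfl

/-- **`avoidStr2 ∈ FP`** (generic bridge stated for an arbitrary `g`, so that no unfolding of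
`avoidStr2` is attempted; cf. `ADH.PCSpec.mem_FP_of_code`, not imported here). -/
theorem avoidStr2_mem_FP : avoidStr2 ∈ FP := by
  have key : ∀ {g : List Bool → List Bool}, CodeFP strE strE g → g ∈ FP := by
    rintro g ⟨f, hf, hfg⟩
    have hfg' : f = g := funext hfg
    exact hfg' ▸ hf
  exact key codeFP_avoidStr2

/-- **`avoidStr2` is polynomial-time computable** (`IsPolyTime`; bridge `isPolyTime_iff`). -/
theorem isPolyTime_avoidStr2 : IsPolyTime avoidStr2 := (isPolyTime_iff avoidStr2).mpr avoidStr2_mem_FP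

end PolyTime

/-! ## The rung -/

/-- **Matching-class rung, literally typed (BC5 / T3 witness for C₁ = `CandAvoidLinearFP`, inside
the `CAND^match` core).** For every `k`, pure-`CAND` `NC⁰₃`-range avoidance restricted to
matching-class instances with `headCount³ ≤ k·n` is solved at linear stretch `m ≥ (22k+1)·n` by ONE
polynomial-time string function: the statement `LocalAvoidLinearFP 3 (IsPure candPred ∧
IsMatchingClass ∧ headCount³ ≤ k·n)`, i.e. the crux C₁ with its side condition strengthened.
(Restricted-model algorithmic rung; no bearing on `P ≠ NP`.) -/
theorem candMatch_rungFP (k : ℕ) :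
    LocalAvoidLinearFP 3 (fun n _ I => I.IsPure candPred ∧ IsMatchingClass I ∧ headCount I ^ 3 ≤ k * n) := by
  refine ⟨22 * k + 1, avoidStr2, isPolyTime_avoidStr2, fun n m I hQ hn hm => ?_⟩
  rw [avoidStr2_encode hQ.1]
  exact answer2_not_mem_range hQ.1 hQ.2.1 hQ.2.2 hn hm

end Summit.PneNP.PneNP.Theorems.Nc03AvoidResidualCoreCandMatchRungFP
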